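import Summits.HodgeConjecture.HodgeConjecture.Cruxes.BlochSeedDiscOne.RuleDPlate

/-!
line stmt-HodgeConjecture-18881 Cruxes/BlochSeedDiscOne/Lines/birth.lean 814a6a70c14e831a stub_rung_pad4_seedAt

# PortHallLegSurplus — ROW-α2 of director R19.832 (D3): PortHall₈ (`RuleDPlate.HallPlusUp · 8`) THEOREM-OR-COUNTEREXAMPLE for
# split-block sheaf-door designs (planner `plan-lens-HodgeAV-negation` g26, 2026-08-31; memo `PORTHALL8-ROW-A2-negation-g26.md` beside this file)

STATUS ∕ SCOPE.  Letter-model statements about `DepthBoundA4.Design` only (a count on the weakly-live incidence pattern of a letter design ≠ a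
sheaf ≠ a block ≠ a SEED ≠ the kernel of any stub).  NOTHING here is proved toward HC ∕ HC_CM ∕ HC_AV ∕ №4 ∕ 26512 ∕ 18881 ∕ H2; no stub of any
skeleton is registered or touched.  `import` of a BUILT module only (`RuleDPlate`); no `axiom`, no `instance`, no notation, no `sorry`, no
`native_decide`; `decide` only on closed integer ∕ list terms of a handful of entries.

VERDICT TYPED HERE (the geometry is in the memo; the dictionary is: a block entry `L_σ → L_τ` of a split two-term presentation
`0 → ⊕_P L_σ^{m_σ} → ⊕_N L_τ^{n_τ} → 𝓔 → 0` on `X = (E₀²)⁴` is a section of `L_τ ⊗ L_σ⁻¹ = ⊠_f 𝒪_{E₀²}(τ_f − σ_f)`, non-zero only if every factor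
step `σ_f → τ_f` is NOT DEAD (`DepthBoundA4.WeakLive`); a not-dead step is EQUAL (trivial factor, contributes 0 dimensions), NULL
(`LeggedFloor.NullStep`, `Δa² = Δx² + Δy²`: the factor bundle is pulled back from the quotient elliptic curve `E₀² ∕ C_ε`, contributes 1) or AMPLE
(`DepthBoundA4.AmpleAbove`, contributes 2); the sum over the four factors is the LEG DIMENSION `pairDim σ τ ∈ {0,…,8}` = the dimension of the
variety the Hom bundle of the pair is pulled back from):

* §1 `legDim`, `pairDim` and their values on equal ∕ null ∕ ample steps (`pairDim_eq_eight_of_live`: four-ample pairs have leg dimension 8).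
* §2 the LEG-SURPLUS ROW `HallPlusLegUp E`: the shape of `HallPlusUp` with the surplus `8` replaced by any `d ≤ 8` not exceeding the leg dimension
  of every weakly-live pair of the column set — the expected-dimension count of the Porteous stratum done with the dimension the block actually
  lives over.  PROVED: `HallPlusUp E 8 → HallPlusLegUp E → HallPlusAmpleUp E 8` and `HallPlusLegUp E → HallUp E`; on LEG-FREE designs (every
  weakly-live entry pair four-ample, `EntrySharp`, = colour-1's (A4♯) at entry level) the rows `HallPlusUp · 8` and `HallPlusLegUp` COINCIDE
  (`hallPlusUp_eight_iff_hallPlusLegUp`).  So PortHall₈ and the leg row differ EXACTLY on legged column sets.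
* §3 TWO COUNTEREXAMPLE DESIGNS on the height-14 alphabet, disjoint supports (`C1_scope`, `C2_scope`), each realised (memo §3) by an honest
  fibrewise-injective split block with locally free cokernel — `C1`: one NULL leg of content 2 (`P = [(σ₁,1)]`, `N = [(τ₁,2)]`,
  `σ₁ = (hub,hub,hub,(2;−12,0))`, `τ₁ = (hub,hub,hub,(4;−10,0))`, difference `(2;2,0) = 2·(1;1,0)`, two sections of a degree-2 pencil on the
  quotient curve with no common zero); `C2`: one AMPLE leg (`P = [(σ₂,1)]`, `N = [(hub⁴,3)]`, `σ₂ = (hub,hub,hub,(10;2,2))`, difference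
  `(4;−2,−2) = 2·(2;−1,−1)`, three general sections of a base-point-free ample bundle on the surface factor).  KERNEL-CHECKED: both VIOLATE
  `HallPlusUp · 8` (indeed `C1` violates every surplus `≥ 2`, `C2` every surplus `≥ 3`) and both SATISFY the leg row (`hallPlusLegUp_C1`,
  `hallPlusLegUp_C2`) and the tree's door-1 row `HallUp`.

READING (for the director ∕ the checker owner ∕ the dual seat; details and the price preview in the memo): as a LAW «every letter design realised by a
split block with locally free cokernel satisfies `HallPlusUp · 8`» PortHall₈ is FALSE (C1, C2 are realised, in scope, and violate it); its
theorem-grade core is `HallPlusAmpleUp · 8` (Fulton–Lazarsfeld, complete four-ample column sets) [cite: Fulton1998, Example 12.1.6]; the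
necessary row on legged column sets is at most the leg surplus (`HallPlusLegUp`, generically sharp on globally generated uniform-leg blocks
[cite: Fulton1998, Example 12.1.5 and Lemma B.9.1]); the top instance `8 ≤ rank` survives only as the PADDING CONVENTION (director R19.839), not
as a theorem.  Whether every split-block SEED (all seed rows imposed) happens to satisfy PortHall₈ is a different, open question that no modular
row argument in the tree addresses.
-/

set_option linter.dupNamespace false
set_option autoImplicit false

namespace Summit.HodgeConjecture.HodgeConjecture.Cruxes.BlochSeedDiscOne.PortHallLeg

open Summit.HodgeConjecture.HodgeConjecture.Cruxes.BlochSeedDiscOne.DepthBoundA4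
open Summit.HodgeConjecture.HodgeConjecture.Cruxes.BlochSeedDiscOne.LeggedFloor
open Summit.HodgeConjecture.HodgeConjecture.Cruxes.BlochSeedDiscOne.HallB136
open Summit.HodgeConjecture.HodgeConjecture.Cruxes.BlochSeedDiscOne.RuleDPlate

/-! ## §1 Leg dimension of a not-dead step and of a cell pair -/

/-- **leg dimension of a factor step** `ℓ → ℓ'`: `0` if EQUAL, `1` if the difference is isotropic (`Δx² + Δy² = Δa²`, the NULL case when the
step is not dead), `2` otherwise (the AMPLE case when the step is not dead).  On a dead step the value is meaningless and never used. -/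
def legDim (ℓ ℓ' : Letter) : ℕ :=
  if ℓ = ℓ' then 0 else if (ℓ'.x - ℓ.x) ^ 2 + (ℓ'.y - ℓ.y) ^ 2 = (ℓ'.a - ℓ.a) ^ 2 then 1 else 2

theorem legDim_le_two (ℓ ℓ' : Letter) : legDim ℓ ℓ' ≤ 2 := by
  unfold legDim
  split_ifs <;> omega

theorem legDim_self (ℓ : Letter) : legDim ℓ ℓ = 0 := by
  simp [legDim]

theorem legDim_eq_one_of_nullStep {ℓ ℓ' : Letter} (h : NullStep ℓ ℓ') : legDim ℓ ℓ' = 1 := by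
  have h1 : ℓ ≠ ℓ' := by
    rintro rfl
    exact lt_irrefl _ h.1
  simp [legDim, h1, h.2]

theorem legDim_eq_two_of_ampleAbove {ℓ ℓ' : Letter} (h : AmpleAbove ℓ ℓ') : legDim ℓ ℓ' = 2 := by
  have h1 : ℓ ≠ ℓ' := by
    rintro rfl
    exact lt_irrefl _ h.1
  have h2 : (ℓ'.x - ℓ.x) ^ 2 + (ℓ'.y - ℓ.y) ^ 2 ≠ (ℓ'.a - ℓ.a) ^ 2 := ne_of_lt h.2
  simp [legDim, h1, h2]

/-- trichotomy of a not-dead step: EQUAL, NULL or AMPLE. -/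
theorem notDead_cases {ℓ ℓ' : Letter} (h : NotDead ℓ ℓ') : ℓ = ℓ' ∨ NullStep ℓ ℓ' ∨ AmpleAbove ℓ ℓ' := by
  rcases h with h | ⟨ha, hle⟩
  · exact Or.inl h
  · rcases lt_or_eq_of_le hle with hlt | heq
    · exact Or.inr (Or.inr ⟨ha, hlt⟩)
    · exact Or.inr (Or.inl ⟨ha, heq⟩)

/-- on a not-dead step the leg dimension is `0 ∕ 1 ∕ 2` according as the step is EQUAL ∕ NULL ∕ AMPLE. -/
theorem legDim_of_notDead {ℓ ℓ' : Letter} (h : NotDead ℓ ℓ') :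
    (ℓ = ℓ' ∧ legDim ℓ ℓ' = 0) ∨ (NullStep ℓ ℓ' ∧ legDim ℓ ℓ' = 1) ∨ (AmpleAbove ℓ ℓ' ∧ legDim ℓ ℓ' = 2) := by
  rcases notDead_cases h with h | h | h
  · subst h
    exact Or.inl ⟨rfl, legDim_self _⟩
  · exact Or.inr (Or.inl ⟨h, legDim_eq_one_of_nullStep h⟩)
  · exact Or.inr (Or.inr ⟨h, legDim_eq_two_of_ampleAbove h⟩)

/-- **leg dimension of a cell pair** `x → y`: the sum over the four factors (= the dimension of the product of points ∕ quotient elliptic curves ∕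
surface factors the pair's Hom line bundle is pulled back from, when the pair is weakly live). -/
def pairDim (x y : Cell) : ℕ :=
  legDim (x 0) (y 0) + legDim (x 1) (y 1) + legDim (x 2) (y 2) + legDim (x 3) (y 3)

theorem pairDim_le_eight (x y : Cell) : pairDim x y ≤ 8 := by
  have h0 := legDim_le_two (x 0) (y 0)
  have h1 := legDim_le_two (x 1) (y 1)
  have h2 := legDim_le_two (x 2) (y 2)
  have h3 := legDim_le_two (x 3) (y 3)
  unfold pairDim
  omega

theorem pairDim_self (x : Cell) : pairDim x x = 0 := by
  simp [pairDim, legDim_self]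

/-- a FOUR-AMPLE pair has leg dimension `8 = dim (E₀²)⁴`. -/
theorem pairDim_eq_eight_of_live {x y : Cell} (h : Live x y) : pairDim x y = 8 := by
  simp [pairDim, legDim_eq_two_of_ampleAbove (h 0), legDim_eq_two_of_ampleAbove (h 1), legDim_eq_two_of_ampleAbove (h 2),
    legDim_eq_two_of_ampleAbove (h 3)]

/-- converse soundness of the tree's raw test `HallB136.notDeadB` (the tree has `notDeadB_of`). -/
theorem notDead_of_notDeadB {ℓ ℓ' : Letter} (h : notDeadB ℓ ℓ' = true) : NotDead ℓ ℓ' := by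
  simp only [notDeadB, Bool.or_eq_true, Bool.and_eq_true, decide_eq_true_eq] at h
  rcases h with ⟨⟨ha, hx⟩, hy⟩ | ⟨ha, hle⟩
  · left
    cases ℓ
    cases ℓ'
    simp_all
  · right
    refine ⟨ha, ?_⟩
    simpa [sq] using hle

/-- converse soundness of `HallB136.weakLiveB`. -/
theorem weakLive_of_weakLiveB {x y : Cell} (h : weakLiveB x y = true) : WeakLive x y := by
  simp only [weakLiveB, Bool.and_eq_true] at h
  obtain ⟨⟨⟨h0, h1⟩, h2⟩, h3⟩ := h
  intro f
  fin_cases f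
  · exact notDead_of_notDeadB h0
  · exact notDead_of_notDeadB h1
  · exact notDead_of_notDeadB h2
  · exact notDead_of_notDeadB h3

/-! ## §2 The leg-surplus row and its place between PortHall₈ and the ample row -/

/-- **LEG-SURPLUS ROW `HallPlusLegUp`** (replacement candidate for PortHall₈ on legged column sets): for every sub-list `S` of P-entries of
positive mass and every list `T` of N-entries containing each N-entry weakly live above some entry of `S`, and every `d ≤ 8` not exceeding the
leg dimension of ANY weakly-live pair in `S × T`, `Σ_S m + d ≤ Σ_T n`.  (The surplus is the least leg dimension met on the column set; dead
pairs — zero entries — impose nothing; `d = 0` is always admissible, so the row contains `HallUp`.) -/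
def HallPlusLegUp (E : Design) : Prop :=
  ∀ S : List (Cell × ℕ), S.Sublist E.P → 0 < (S.map Prod.snd).sum →
    ∀ T : List (Cell × ℕ), T.Sublist E.N →
      (∀ cn ∈ E.N, (∃ cm ∈ S, WeakLive cm.1 cn.1) → cn ∈ T) →
        ∀ d : ℕ, d ≤ 8 → (∀ cm ∈ S, ∀ cn ∈ T, WeakLive cm.1 cn.1 → d ≤ pairDim cm.1 cn.1) →
          (S.map Prod.snd).sum + d ≤ (T.map Prod.snd).sum

/-- PortHall₈ implies the leg row (the surplus only drops). -/
theorem hallPlusLegUp_of_hallPlusUp_eight (E : Design) (h : HallPlusUp E 8) : HallPlusLegUp E :=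
  fun S hS hpos T hT hcov _ hd _ => le_trans (Nat.add_le_add_left hd _) (h S hS hpos T hT hcov)

/-- more generally: a surplus-`k` row together with «every weakly-live entry pair has leg dimension `≤ k`» gives the leg row. -/
theorem hallPlusLegUp_of_hallPlusUp_of_pairDim_le (E : Design) (k : ℕ) (h : HallPlusUp E k)
    (hk : ∀ cm ∈ E.P, ∀ cn ∈ E.N, WeakLive cm.1 cn.1 → pairDim cm.1 cn.1 ≤ k) : HallPlusLegUp E := by
  intro S hS hpos T hT hcov d _ hdim
  by_cases hex : ∃ cm ∈ S, ∃ cn ∈ T, WeakLive cm.1 cn.1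
  · obtain ⟨cm, hcm, cn, hcn, hw⟩ := hex
    have h1 : d ≤ k := le_trans (hdim cm hcm cn hcn hw) (hk cm (hS.subset hcm) cn (hT.subset hcn) hw)
    exact le_trans (Nat.add_le_add_left h1 _) (h S hS hpos T hT hcov)
  · push Not at hex
    have h0 := h S hS hpos [] (List.nil_sublist _)
      (fun cn hcnE hx => by
        obtain ⟨cm, hcm, hw⟩ := hx
        exact (hex cm hcm cn (hcov cn hcnE ⟨cm, hcm, hw⟩) hw).elim)
    simp at h0
    omega

/-- the leg row implies the RIGOROUS CORE `HallPlusAmpleUp · 8` (four-ample pairs have leg dimension 8). -/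
theorem hallPlusAmpleUp_eight_of_hallPlusLegUp (E : Design) (h : HallPlusLegUp E) : HallPlusAmpleUp E 8 := by
  intro S hS hpos T hT hcov hlive
  exact h S hS hpos T hT hcov 8 le_rfl (fun cm hcm cn hcn _ => by rw [pairDim_eq_eight_of_live (hlive cm hcm cn hcn)])

/-- the leg row contains the tree's door-1 row `HallUp` (`d = 0`). -/
theorem hallUp_of_hallPlusLegUp (E : Design) (h : HallPlusLegUp E) : HallUp E :=
  (hallUp_iff_hallPlusUp_zero E).mpr
    (fun S hS hpos T hT hcov => h S hS hpos T hT hcov 0 (Nat.zero_le _) (fun _ _ _ _ _ => Nat.zero_le _))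

/-- **LEG-FREE designs** (colour-1's (A4♯) at ENTRY level): every weakly-live P→N entry pair is four-ample. -/
def EntrySharp (E : Design) : Prop :=
  ∀ cm ∈ E.P, ∀ cn ∈ E.N, WeakLive cm.1 cn.1 → Live cm.1 cn.1

/-- on a leg-free design the leg row gives PortHall₈ back … -/
theorem hallPlusUp_eight_of_hallPlusLegUp (E : Design) (hA : EntrySharp E) (h : HallPlusLegUp E) : HallPlusUp E 8 :=
  fun S hS hpos T hT hcov => h S hS hpos T hT hcov 8 le_rfl
    (fun cm hcm cn hcn hw => by rw [pairDim_eq_eight_of_live (hA cm (hS.subset hcm) cn (hT.subset hcn) hw)])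

/-- … so PortHall₈ and the leg row COINCIDE on leg-free designs: they differ exactly on legged column sets. -/
theorem hallPlusUp_eight_iff_hallPlusLegUp (E : Design) (hA : EntrySharp E) : HallPlusUp E 8 ↔ HallPlusLegUp E :=
  ⟨hallPlusLegUp_of_hallPlusUp_eight E, hallPlusUp_eight_of_hallPlusLegUp E hA⟩

/-! ## §3 The counterexample designs `C1` (null leg) and `C2` (ample leg) at height 14 -/

/-- the height-14 hub `(14; 0, 0)`. -/
def hub14 : Letter := ⟨14, 0, 0⟩

/-- `σ₁ = (hub, hub, hub, (2;−12,0))`. -/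
def sigma1 : Cell := cellOf hub14 hub14 hub14 ⟨2, -12, 0⟩
/-- `τ₁ = (hub, hub, hub, (4;−10,0))`: above `σ₁` by three EQUAL steps and one NULL step `(2;2,0) = 2·(1;1,0)` (content 2). -/
def tau1 : Cell := cellOf hub14 hub14 hub14 ⟨4, -10, 0⟩
/-- `σ₂ = (hub, hub, hub, (10;2,2))`: below `hub⁴` by three EQUAL steps and one AMPLE step `(4;−2,−2) = 2·(2;−1,−1)`. -/
def sigma2 : Cell := cellOf hub14 hub14 hub14 ⟨10, 2, 2⟩
/-- the hub cell `hub⁴` at height 14. -/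
def hub4h14 : Cell := cellOf hub14 hub14 hub14 hub14

/-- **C1** (null leg): `N = [(τ₁, 2)]`, `P = [(σ₁, 1)]` — rank 1, 3 copies. -/
def C1 : Design := { N := [(tau1, 2)], P := [(sigma1, 1)] }

/-- **C2** (ample leg): `N = [(hub⁴, 3)]`, `P = [(σ₂, 1)]` — rank 2, 4 copies. -/
def C2 : Design := { N := [(hub4h14, 3)], P := [(sigma2, 1)] }

theorem C1_rank : C1.rank = 1 ∧ C1.copies = 3 := by decide

theorem C2_rank : C2.rank = 2 ∧ C2.copies = 4 := by decide

theorem weakLive_sigma1_tau1 : WeakLive sigma1 tau1 := weakLive_of_weakLiveB (by decide)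

theorem weakLive_sigma2_hub : WeakLive sigma2 hub4h14 := weakLive_of_weakLiveB (by decide)

/-- the legs: `σ₁ → τ₁` is NULL on the last factor, `σ₂ → hub⁴` is AMPLE on the last factor; the other three factors are EQUAL. -/
theorem legs : NullStep (sigma1 3) (tau1 3) ∧ AmpleAbove (sigma2 3) (hub4h14 3) ∧
    (∀ f : Fin 4, f ≠ 3 → sigma1 f = tau1 f ∧ sigma2 f = hub4h14 f) := by
  refine ⟨⟨by decide, by decide⟩, ⟨by decide, by decide⟩, ?_⟩
  decide

/-- neither pair is four-ample (so the rigorous core `HallPlusAmpleUp` says nothing about these column sets). -/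
theorem not_live : ¬ Live sigma1 tau1 ∧ ¬ Live sigma2 hub4h14 := by
  constructor
  · intro h
    exact absurd (h 0).1 (by decide)
  · intro h
    exact absurd (h 0).1 (by decide)

theorem pairDim_C1 : pairDim sigma1 tau1 = 1 := by decide

theorem pairDim_C2 : pairDim sigma2 hub4h14 = 2 := by decide

/-- SCOPE rows: both designs live on the height-14 alphabet with disjoint supports. -/
theorem C1_scope : C1.OnAlphabet 14 ∧ Disj C1 := by
  constructor
  · intro c hc f
    have hc' : c = tau1 ∨ c = sigma1 := by simpa [C1, Design.suppN, Design.suppP] using hc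
    rcases hc' with rfl | rfl <;> fin_cases f <;> exact ⟨by decide, by decide⟩
  · intro c hN hP
    have h1 : c = tau1 := by simpa [C1, Design.suppN] using hN
    have h2 : c = sigma1 := by simpa [C1, Design.suppP] using hP
    have h3 : tau1 3 = sigma1 3 := by rw [← h1, ← h2]
    exact absurd h3 (by decide)

theorem C2_scope : C2.OnAlphabet 14 ∧ Disj C2 := by
  constructor
  · intro c hc f
    have hc' : c = hub4h14 ∨ c = sigma2 := by simpa [C2, Design.suppN, Design.suppP] using hc
    rcases hc' with rfl | rfl <;> fin_cases f <;> exact ⟨by decide, by decide⟩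
  · intro c hN hP
    have h1 : c = hub4h14 := by simpa [C2, Design.suppN] using hN
    have h2 : c = sigma2 := by simpa [C2, Design.suppP] using hP
    have h3 : hub4h14 3 = sigma2 3 := by rw [← h1, ← h2]
    exact absurd h3 (by decide)

/-- **C1 violates every surplus row `HallPlusUp · k` with `k ≥ 2`** — in particular PortHall₈: the column set `S = P` sees `T = N` of mass 2. -/
theorem not_hallPlusUp_C1 {k : ℕ} (hk : 2 ≤ k) : ¬ HallPlusUp C1 k := by
  intro h
  have h1 := h C1.P (List.Sublist.refl _) (by decide) C1.N (List.Sublist.refl _) (fun _ hcn _ => hcn)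
  have e1 : (C1.P.map Prod.snd).sum = 1 := by decide
  have e2 : (C1.N.map Prod.snd).sum = 2 := by decide
  rw [e1, e2] at h1
  omega

theorem not_hallPlusUp_eight_C1 : ¬ HallPlusUp C1 8 := not_hallPlusUp_C1 (by norm_num)

/-- **C2 violates every surplus row `HallPlusUp · k` with `k ≥ 3`** — in particular PortHall₈. -/
theorem not_hallPlusUp_C2 {k : ℕ} (hk : 3 ≤ k) : ¬ HallPlusUp C2 k := by
  intro h
  have h1 := h C2.P (List.Sublist.refl _) (by decide) C2.N (List.Sublist.refl _) (fun _ hcn _ => hcn)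
  have e1 : (C2.P.map Prod.snd).sum = 1 := by decide
  have e2 : (C2.N.map Prod.snd).sum = 3 := by decide
  rw [e1, e2] at h1
  omega

theorem not_hallPlusUp_eight_C2 : ¬ HallPlusUp C2 8 := not_hallPlusUp_C2 (by norm_num)

/-- the only positive-mass column set of a one-entry P side is the entry itself, and its covering row list is the one N entry. -/
theorem columns_of_singletons {σ τ : Cell} {m n : ℕ} (hw : WeakLive σ τ)
    {S T : List (Cell × ℕ)} (hS : S.Sublist [(σ, m)]) (hpos : 0 < (S.map Prod.snd).sum) (hT : T.Sublist [(τ, n)])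
    (hcov : ∀ cn ∈ [(τ, n)], (∃ cm ∈ S, WeakLive cm.1 cn.1) → cn ∈ T) : S = [(σ, m)] ∧ T = [(τ, n)] := by
  have hS' : S = [(σ, m)] := by
    rcases List.sublist_singleton.1 hS with h | h
    · subst h
      simp at hpos
    · exact h
  subst hS'
  have hmem : (τ, n) ∈ T := hcov (τ, n) (List.mem_singleton.2 rfl) ⟨(σ, m), List.mem_singleton.2 rfl, hw⟩
  have hT' : T = [(τ, n)] := by
    rcases List.sublist_singleton.1 hT with h | h
    · subst h
      simp at hmem
    · exact h
  exact ⟨rfl, hT'⟩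

/-- **C1 satisfies the leg row** (surplus `≤ pairDim σ₁ τ₁ = 1`: `1 + 1 ≤ 2`). -/
theorem hallPlusLegUp_C1 : HallPlusLegUp C1 := by
  intro S hS hpos T hT hcov d _ hdim
  obtain ⟨rfl, rfl⟩ := columns_of_singletons weakLive_sigma1_tau1 hS hpos hT hcov
  have hd : d ≤ 1 := by
    have := hdim (sigma1, 1) (List.mem_singleton.2 rfl) (tau1, 2) (List.mem_singleton.2 rfl) weakLive_sigma1_tau1
    rwa [pairDim_C1] at this
  simp
  omega

/-- **C2 satisfies the leg row** (surplus `≤ pairDim σ₂ hub⁴ = 2`: `1 + 2 ≤ 3`). -/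
theorem hallPlusLegUp_C2 : HallPlusLegUp C2 := by
  intro S hS hpos T hT hcov d _ hdim
  obtain ⟨rfl, rfl⟩ := columns_of_singletons weakLive_sigma2_hub hS hpos hT hcov
  have hd : d ≤ 2 := by
    have := hdim (sigma2, 1) (List.mem_singleton.2 rfl) (hub4h14, 3) (List.mem_singleton.2 rfl) weakLive_sigma2_hub
    rwa [pairDim_C2] at this
  simp
  omega

/-- C1 satisfies the surplus-1 row and C2 the surplus-2 row (their leg surpluses) — and hence the door-1 row `HallUp`. -/
theorem hallPlusUp_one_C1 : HallPlusUp C1 1 := by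
  intro S hS hpos T hT hcov
  obtain ⟨rfl, rfl⟩ := columns_of_singletons weakLive_sigma1_tau1 hS hpos hT hcov
  decide

theorem hallPlusUp_two_C2 : HallPlusUp C2 2 := by
  intro S hS hpos T hT hcov
  obtain ⟨rfl, rfl⟩ := columns_of_singletons weakLive_sigma2_hub hS hpos hT hcov
  decide

theorem hallUp_C1_C2 : HallUp C1 ∧ HallUp C2 :=
  ⟨hallUp_of_hallPlusUp C1 1 hallPlusUp_one_C1, hallUp_of_hallPlusUp C2 2 hallPlusUp_two_C2⟩

/-- SUMMARY of §3: two in-scope designs separating PortHall₈ from its rigorous core and from the leg row. -/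
theorem portHall_eight_separated :
    (¬ HallPlusUp C1 8 ∧ HallPlusLegUp C1 ∧ HallPlusAmpleUp C1 8 ∧ HallUp C1) ∧
    (¬ HallPlusUp C2 8 ∧ HallPlusLegUp C2 ∧ HallPlusAmpleUp C2 8 ∧ HallUp C2) :=
  ⟨⟨not_hallPlusUp_eight_C1, hallPlusLegUp_C1, hallPlusAmpleUp_eight_of_hallPlusLegUp C1 hallPlusLegUp_C1, hallUp_C1_C2.1⟩,
   ⟨not_hallPlusUp_eight_C2, hallPlusLegUp_C2, hallPlusAmpleUp_eight_of_hallPlusLegUp C2 hallPlusLegUp_C2, hallUp_C1_C2.2⟩⟩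

/-! ## Audit: nothing is decided here

`HallPlusLegUp`, `EntrySharp` are `Prop`s on letter designs; `C1`, `C2` are three- and four-copy letter designs, not seeds (they are not claimed
to pass `A1`, RULE D, `μ ≠ 0` or the budget).  Every theorem is an implication between letter-model rows or a `decide` on a closed term.  The
geometric realisation of `C1`, `C2` by split blocks and the Fulton–Lazarsfeld status of the rows are ARGUED IN THE MEMO, not formalised. -/

end Summit.HodgeConjecture.HodgeConjecture.Cruxes.BlochSeedDiscOne.PortHallLeg
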